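import Literature.Probability.RandomPlanarGeometry.LoewnerSlitFlow
import Literature.Probability.RandomPlanarGeometry.LoewnerSlitTheorem
import Literature.Probability.RandomPlanarGeometry.LoewnerHullCocycle
import Literature.Probability.RandomPlanarGeometry.HalfDiscCapacity
import HarnessLib

/-!
# Proof of the normalized Loewner flow of a smooth hull (`IsArcHull.exists_normalizedLoewnerFlow`)

G. F. Lawler, O. Schramm, W. Werner, *Conformal restriction: the chordal case*, J. Amer. Math.
Soc. **16** (2003), proof of Lemma 3.5 (arXiv p. 13): "`β : [0, s] → ℍ̄` … parametrized by
half-plane capacity … `Φ_t := Φ_{β[0,t]} = g_t - g_t(0)` … `Ũ_t := U_t - g_t(0)` … By the chordal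
version of Loewner's theorem, `∂_t g_t(z) = 2/(g_t(z) - U_t)`. Thus
`∂_t Φ_t(z) = 2/(Φ_t(z) - Ũ_t) + 2/Ũ_t = 2Φ_t(z)/((Φ_t(z) - Ũ_t) Ũ_t)` … `Ũ_t` is continuous and
positive … `Φ_s = Φ_{E_δ}`"; the theorem invoked is G. F. Lawler, *Conformally Invariant
Processes in the Plane* (2005), §4.1 (Lemma 4.2, Prop. 4.4, Remark 4.5), and `s = hcap/2 ≤ rad²/2`
is (3.9) there.

This proof-only file DISCHARGES the named fact
`Literature.Probability.RandomPlanarGeometry.IsArcHull.exists_normalizedLoewnerFlow` of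
`LoewnerSlitFlow` (`…_holds` below) by assembling results already proved in the tree:

* Loewner's slit theorem for the boundary path of an arc hull (`LoewnerSlitTheorem`,
  `SlitArcData`: the continuous driving function `W = h.driving`, `W_0 = γ(0) > 0`, the terminal
  time `S = hcap(J)/2`, the hulls `K_t = γ(0, σ t]` of the chain for `t < S` and `K_S = J ∩ ℍ`);
* the forward theory of the chain of a continuous driving function: the normalized maps
  `Φ_t = g_t - g_t(0)` as restriction maps of `closure K_t` (`Loewner.normalizedMap`,
  `isRestrictionMap_normalizedMap`), positivity of `Ũ_t = W_t - g_t(0)`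
  (`exists_forall_le_driving_sub_map_zero`), joint continuity (`continuousOn_map_prod`), the
  flows `g_t(z)`, `g_t(0)` as solutions of `ġ = 2/(g - W)` (`IsSolution`), whence the
  normalized equation by the algebra `2/(g - W) - 2/(g₀ - W) = 2Φ/((Φ - Ũ) Ũ)`;
* the hull cocycle `g_t(K_S ∖ K_t) = K^{W(t+·)}_{S-t}` (`LoewnerHullCocycle`) and
  `W'_0 ∈ closure K'_u` (`driving_mem_closure_hull`), giving `Ũ_t ∈ cl Φ_t((J ∖ K_t) ∩ ℍ)`;
* Lawler's (3.9) `hcap(J) ≤ rad(J)²` (`HalfDiscCapacity`), giving `s ≤ R²/2`.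

## References

* [LSW] proof of Lemma 3.5, p. 13 [LawlerSchrammWerner2003Restriction].
* G. F. Lawler (2005), §4.1: Lemma 4.2, Prop. 4.4, Remark 4.5; §3.4 (3.9) [Lawler2005].
-/

noncomputable section

open Set Filter Metric Function Complex
open _root_.Topology
open UpperHalfPlane (upperHalfPlaneSet isOpen_upperHalfPlaneSet)
open scoped NNReal

namespace Literature.Probability.RandomPlanarGeometry

/-! ### The algebra of the normalization -/

/-- `2/(G - w) - 2/(G₀ - w) = 2Φ/((Φ - Ũ) Ũ)` with `Φ = G - G₀`, `Ũ = w - G₀` ([LSW] p. 13: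
"`∂_t Φ_t(z) = 2/(Φ_t(z) - Ũ_t) + 2/Ũ_t = 2Φ_t(z)/((Φ_t(z) - Ũ_t) Ũ_t)`"). [cite: LawlerSchrammWerner2003Restriction, proof of Lemma 3.5 (p. 13)] -/
theorem loewner_normalized_identity {G G₀ w : ℂ} (h1 : G ≠ w) (h2 : G₀ ≠ w) :
    2 / (G - w) - 2 / (G₀ - w) = 2 * (G - G₀) / (((G - G₀) - (w - G₀)) * (w - G₀)) := by
  have h3 : G - w ≠ 0 := sub_ne_zero.2 h1
  have h4 : w - G₀ ≠ 0 := sub_ne_zero.2 (Ne.symm h2)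
  have h5 : G₀ - w ≠ 0 := sub_ne_zero.2 h2
  have : (G - G₀) - (w - G₀) = G - w := by ring
  rw [this]
  field_simp
  ring

namespace Loewner

variable {W : ℝ≥0 → ℝ}

/-! ### Forward theory: the normalized flow of a continuous driving function -/

/-- **The tip is in the closure of the image of the remaining hull**: `W_t ∈ cl g_t(K_S ∖ K_t)`
for `t < S` (the cocycle `g_t(K_S ∖ K_t) = K^{W(t+·)}_{S-t}` and `W'_0 ∈ cl K'_u` for `u > 0`).
[cite: Lawler2005, Ch. 4: Rem. 4.9, Lemma 4.13] -/
theorem driving_mem_closure_image_hull_diff (hW : Continuous W) {t S : ℝ≥0} (ht : t < S) :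
    ((W t : ℝ) : ℂ) ∈ closure (map W t '' (hull W S \ hull W t)) := by
  obtain ⟨u, rfl⟩ : ∃ u, S = t + u := ⟨S - t, (add_tsub_cancel_of_le ht.le).symm⟩
  have hu : 0 < u := (lt_add_iff_pos_right t).1 ht
  rw [hull_add_sdiff_eq_image hW t u, image_image]
  have heq : (fun x ↦ map W t (loewnerInv W t x)) '' hull (fun v ↦ W (t + v)) u =
      hull (fun v ↦ W (t + v)) u := by
    refine Subset.antisymm ?_ fun w hw ↦ ⟨w, hw, map_loewnerInv hW t (hull_subset _ _ hw)⟩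
    rintro _ ⟨w, hw, rfl⟩
    show map W t (loewnerInv W t w) ∈ _
    rw [map_loewnerInv hW t (hull_subset _ _ hw)]
    exact hw
  rw [heq]
  have hW' : Continuous fun v ↦ W (t + v) := hW.comp (continuous_const.add continuous_id)
  simpa using driving_mem_closure_hull hW' hu

/-- **The normalized flow solves the normalized Loewner equation**: for `0`, `z` flowing beyond
`S`, `t ↦ Φ_t(z) = g_t(z) - g_t(0)` satisfies `∂_t Φ_t(z) = 2Φ_t(z)/((Φ_t(z) - Ũ_t) Ũ_t)` on
`[0, S]`, `Ũ_t = W_t - g_t(0)` (both `g_t(z)` and `g_t(0)` solve `ġ = 2/(g - W_t)`).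
[cite: LawlerSchrammWerner2003Restriction, proof of Lemma 3.5 (p. 13)] -/
theorem hasDerivWithinAt_normalizedFlow (hW : Continuous W) {S : ℝ≥0}
    (h0 : (S : WithTop ℝ≥0) < swallowingTime W 0) {z : ℂ}
    (hz : (S : WithTop ℝ≥0) < swallowingTime W z) {t : ℝ} (ht : t ∈ Icc (0 : ℝ) S) :
    HasDerivWithinAt (fun τ : ℝ ↦ map W τ.toNNReal z - (((map W τ.toNNReal 0).re : ℝ) : ℂ))
      (2 * (map W t.toNNReal z - (((map W t.toNNReal 0).re : ℝ) : ℂ)) /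
        ((map W t.toNNReal z - (((map W t.toNNReal 0).re : ℝ) : ℂ) -
            ((W t.toNNReal - (map W t.toNNReal 0).re : ℝ) : ℂ)) *
          ((W t.toNNReal - (map W t.toNNReal 0).re : ℝ) : ℂ)))
      (Icc 0 (S : ℝ)) t := by
  obtain ⟨g, hg⟩ :=
    exists_isSolution_swallowingTime_holds hW (ne_driving_of_lt_swallowingTime hz)
  obtain ⟨g₀, hg₀⟩ :=
    exists_isSolution_swallowingTime_holds hW (ne_driving_of_lt_swallowingTime h0)
  have hDz : Icc 0 (S : ℝ) ⊆
      {τ : ℝ | 0 ≤ τ ∧ (τ.toNNReal : WithTop ℝ≥0) < swallowingTime W z} :=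
    Icc_subset_timeDomain (by rw [Real.toNNReal_coe]; exact hz)
  have hD0 : Icc 0 (S : ℝ) ⊆
      {τ : ℝ | 0 ≤ τ ∧ (τ.toNNReal : WithTop ℝ≥0) < swallowingTime W 0} :=
    Icc_subset_timeDomain (by rw [Real.toNNReal_coe]; exact h0)
  have hgz : ∀ τ ∈ Icc 0 (S : ℝ), map W τ.toNNReal z = g τ := fun τ hτ ↦ by
    rw [map_eq_of_isSolution hW hg (hDz hτ).2, Real.coe_toNNReal τ hτ.1]
  have hg0 : ∀ τ ∈ Icc 0 (S : ℝ), (((map W τ.toNNReal 0).re : ℝ) : ℂ) = g₀ τ :=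
    fun τ hτ ↦ by
      rw [← map_origin_eq_re hW (hD0 hτ).2, map_eq_of_isSolution hW hg₀ (hD0 hτ).2,
        Real.coe_toNNReal τ hτ.1]
  have h1 : HasDerivWithinAt g (vectorField W t (g t)) (Icc 0 (S : ℝ)) t :=
    (hg.isIntegralCurveOn t (hDz ht)).mono hDz
  have h2 : HasDerivWithinAt g₀ (vectorField W t (g₀ t)) (Icc 0 (S : ℝ)) t :=
    (hg₀.isIntegralCurveOn t (hD0 ht)).mono hD0
  have hEq : EqOn (fun τ : ℝ ↦ map W τ.toNNReal z - (((map W τ.toNNReal 0).re : ℝ) : ℂ))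
      (fun τ ↦ g τ - g₀ τ) (Icc 0 (S : ℝ)) := fun τ hτ ↦ by
    simp only [hgz τ hτ, hg0 τ hτ]
  refine ((h1.sub h2).congr hEq (hEq ht)).congr_deriv ?_
  have hne : g t ≠ W t.toNNReal := hg.ne ht.1 (hDz ht).2
  have hne₀ : g₀ t ≠ W t.toNNReal := hg₀.ne ht.1 (hD0 ht).2
  have hU : ((W t.toNNReal - (map W t.toNNReal 0).re : ℝ) : ℂ) = W t.toNNReal - g₀ t := by
    rw [ofReal_sub, hg0 t ht]
  rw [hgz t ht, hg0 t ht, hU, vectorField_apply, vectorField_apply]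
  exact loewner_normalized_identity hne hne₀

/-- **Joint continuity of the normalized flow** `(t, z) ↦ g_t(z) - g_t(0)` on
`[0, S] × {S < T_z}` (`continuousOn_map_prod` and continuity of `t ↦ g_t(0)`). [cite: Lawler2005, Ch. 4 §4.1] -/
theorem continuousOn_normalizedFlow_prod (hW : Continuous W) {S : ℝ≥0}
    (h0 : (S : WithTop ℝ≥0) < swallowingTime W 0) :
    ContinuousOn (fun p : ℝ≥0 × ℂ ↦ map W p.1 p.2 - (((map W p.1 0).re : ℝ) : ℂ))
      (Iic S ×ˢ {z : ℂ | (S : WithTop ℝ≥0) < swallowingTime W z}) := by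
  refine (continuousOn_map_prod hW).sub ?_
  have h1 : ContinuousOn (fun u : ℝ≥0 ↦ (((map W u 0).re : ℝ) : ℂ)) (Iic S) :=
    (continuous_ofReal.comp continuous_re).comp_continuousOn (continuousOn_map_apply hW h0)
  exact h1.comp continuous_fst.continuousOn fun p hp ↦ hp.1

end Loewner

/-! ### Slit theory: the closed hulls, `W_0 > 0`, `T_0 > S`, `S ≤ R²/2` -/

namespace SlitArcData

variable {A : Set ℂ} {γ : ℝ → ℂ}

/-- **The closed hulls before the terminal time are the slits**:
`closure K_t = γ[0, σ t]` for `0 < t < S`. [cite: Lawler2005, §4.1 Prop. 4.4, Remark 4.5] -/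
theorem closure_hull_driving_of_lt (h : SlitArcData A γ) {t : ℝ≥0} (ht0 : 0 < t)
    (ht : t < h.termTime) : closure (Loewner.hull h.driving t) = slit γ (h.sigmaR t) := by
  rw [h.hull_driving_of_lt ht, h.sigma_image_Ioc ht.le]
  have hv : h.sigmaR t ∈ Ioo (0 : ℝ) 1 :=
    h.sigmaR_mem_Ioo ⟨NNReal.coe_pos.2 ht0, NNReal.coe_lt_coe.2 ht⟩
  have hγc : ContinuousOn γ (Icc 0 (h.sigmaR t)) :=
    h.continuousOn.mono (Icc_subset_Icc_right hv.2.le)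
  have hpos : ∀ u ∈ Ioc 0 (h.sigmaR t), 0 < (γ u).im := fun u hu ↦
    h.im_pos u ⟨hu.1, hu.2.trans_lt hv.2⟩
  rw [← slit_inter_upperHalfPlaneSet hv.1 h.im_zero hpos, closure_slit_inter hv.1 hγc h.im_zero hpos]
  rfl

/-- **The closed hull at the terminal time is `A`** (`K_S = A ∩ ℍ` and `A = closure (A ∩ ℍ)`).
[cite: LawlerSchrammWerner2003Restriction, proof of Lemma 3.5 (p. 13, Φ_s = Φ_{E_δ})] -/
theorem closure_hull_driving_termTime (h : SlitArcData A γ) :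
    closure (Loewner.hull h.driving h.termTime) = A := by
  rw [h.hull_driving_termTime, h.isPlusHull.1.isBoundedHull.closure_inter_eq]

/-- `W_0 = γ(0) > 0` (`A ∈ 𝒬₊`). [folklore] -/
theorem driving_zero_pos (h : SlitArcData A γ) : 0 < h.driving 0 := by
  have h1 := congrArg Complex.re h.driving_zero
  rw [ofReal_re] at h1
  rw [h1]
  exact h.re_zero_pos

/-- **The origin is not swallowed by the terminal time: `T_0 > S`** (`0 ∉ A = closure K_S`).
[cite: LawlerSchrammWerner2003Restriction, proof of Lemma 3.5 (p. 13, Ũ_t positive)] -/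
theorem termTime_lt_swallowingTime_zero (h : SlitArcData A γ) :
    (h.termTime : WithTop ℝ≥0) < Loewner.swallowingTime h.driving 0 :=
  Loewner.lt_swallowingTime_zero h.continuous_driving h.driving_zero_pos.ne' (by
    rw [h.closure_hull_driving_termTime]; exact h.isPlusHull.1.zero_notMem)

/-- **`S = hcap(A)/2 ≤ R²/2` when `A ⊆ B̄(0, R)`** (Lawler (2005), (3.9): `hcap(A) ≤ rad(A)²`).
[cite: Lawler2005, §3.4 (3.9)] -/
theorem termTimeR_le (h : SlitArcData A γ) {R : ℝ} (hR : ∀ z ∈ A, ‖z‖ ≤ R) :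
    h.termTimeR ≤ R ^ 2 / 2 := by
  have hRpos : 0 < R := by
    have hm : γ (1 / 2) ∈ A := h.apply_mem ⟨by norm_num, by norm_num⟩
    have him : 0 < (γ (1 / 2)).im := h.im_pos _ ⟨by norm_num, by norm_num⟩
    have h1 := hR _ hm
    have h2 : (γ (1 / 2)).im ≤ ‖γ (1 / 2)‖ := (le_abs_self _).trans (abs_im_le_norm _)
    linarith
  have := h.isHydrodynamicMap_hydroMapA.hcap_le_sq_of_norm_le hRpos hR
  show hcap A h.hydroMapA / 2 ≤ R ^ 2 / 2
  linarith

end SlitArcData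

/-! ### The named fact -/

/-- **The chordal Loewner equation for the boundary arc of a smooth `+`-hull, in the normalized
form of [LSW] p. 13** — the named fact
`Literature.Probability.RandomPlanarGeometry.IsArcHull.exists_normalizedLoewnerFlow` of
`LoewnerSlitFlow`, PROVED. With `h : SlitArcData J γ` (the boundary path `γ` of `J`) the
witnesses are: `s = hcap(J)/2` (`h.termTimeR`), the clock `t ↦ (min t s)⁺`, the hulls
`K_t = closure (Loewner.hull W t)` of the chain driven by `W = h.driving` (`= γ[0, σ t]`, `∅` at
`t = 0`, `J` at `t = s`), the maps `Φ_t = g_t - g_t(0)` (`Loewner.normalizedMap`) and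
`Ũ_t = W_t - g_t(0)`. [cite: LawlerSchrammWerner2003Restriction, proof of Lemma 3.5 (p. 13), the Loewner equation for Φ_t] -/
theorem IsArcHull.exists_normalizedLoewnerFlow_holds : IsArcHull.exists_normalizedLoewnerFlow := by
  intro J hJ hJp R hR
  obtain ⟨γ, hγc, hγi, hγ0, hγ1, hγH, hfr⟩ := hJ.2
  have h : SlitArcData J γ := ⟨hJp, hγc, hγi, hγ0, hγ1, hγH, hfr⟩
  have hW : Continuous h.driving := h.continuous_driving
  have hS0 : 0 < h.termTimeR := h.termTimeR_pos
  have h0T := h.termTime_lt_swallowingTime_zero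
  have hKS := h.closure_hull_driving_termTime
  obtain ⟨lam, hlam, hlamU⟩ :=
    Loewner.exists_forall_le_driving_sub_map_zero hW h.driving_zero_pos h0T
  -- the clock `t ↦ (min t s)⁺ ∈ [0, S]`
  set tc : ℝ → ℝ≥0 := fun t ↦ (min t h.termTimeR).toNNReal with htc
  have htc_cont : Continuous tc := continuous_real_toNNReal.comp (continuous_id.min continuous_const)
  have htcS : ∀ t, tc t ≤ h.termTime := fun t ↦ by
    show (min t h.termTimeR).toNNReal ≤ h.termTime
    rw [← h.toNNReal_termTimeR]
    exact Real.toNNReal_le_toNNReal (min_le_right _ _)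
  have htc_of_mem : ∀ {t}, t ∈ Icc 0 h.termTimeR → tc t = t.toNNReal := fun ht ↦ by
    show (min _ h.termTimeR).toNNReal = _
    rw [min_eq_left ht.2]
  have htc_coe : ∀ {t}, t ∈ Icc 0 h.termTimeR → ((tc t : ℝ≥0) : ℝ) = t := fun ht ↦ by
    rw [htc_of_mem ht, Real.coe_toNNReal _ ht.1]
  have htc0 : tc 0 = 0 := by rw [htc_of_mem ⟨le_rfl, hS0.le⟩, Real.toNNReal_zero]
  have htcs : tc h.termTimeR = h.termTime := by
    rw [htc_of_mem ⟨hS0.le, le_rfl⟩, h.toNNReal_termTimeR]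
  have htc_mono : Monotone tc := fun a b hab ↦ Real.toNNReal_le_toNNReal (min_le_min_right _ hab)
  have htcT0 : ∀ t, ((tc t : ℝ≥0) : WithTop ℝ≥0) < Loewner.swallowingTime h.driving 0 :=
    fun t ↦ lt_of_le_of_lt (WithTop.coe_le_coe.2 (htcS t)) h0T
  have htc_lt : ∀ {t}, t ∈ Ico 0 h.termTimeR → tc t < h.termTime := fun {t} ht ↦ by
    rw [← NNReal.coe_lt_coe, htc_coe ⟨ht.1, ht.2.le⟩, SlitArcData.coe_termTime]
    exact ht.2
  -- points off `J` flow beyond `S`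
  have hoff : ∀ {z}, z ∈ upperHalfPlaneSet \ J →
      (h.termTime : WithTop ℝ≥0) < Loewner.swallowingTime h.driving z := fun {z} hz ↦ by
    have : z ∈ Loewner.domain h.driving h.termTime := by
      rw [← Loewner.diff_closure_hull hW, hKS]; exact hz
    exact ((Loewner.mem_domain_iff _ _ _).1 this).2
  refine ⟨h.termTimeR, fun t ↦ h.driving (tc t) - (Loewner.map h.driving (tc t) 0).re,
    fun t ↦ closure (Loewner.hull h.driving (tc t)), fun t ↦ Loewner.normalizedMap (tc t) hW,
    hS0, h.termTimeR_le hR, ?_, ?_, ?_, ?_, ?_, ?_, ?_, ?_, ?_⟩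
  · -- `Ũ` is continuous
    have h1 : ContinuousOn (fun u : ℝ≥0 ↦ Loewner.map h.driving u 0) (Iic h.termTime) :=
      Loewner.continuousOn_map_apply hW h0T
    have h2 : Continuous fun t ↦ Loewner.map h.driving (tc t) 0 :=
      continuousOn_univ.1 (h1.comp htc_cont.continuousOn fun t _ ↦ htcS t)
    exact ((hW.comp htc_cont).sub (continuous_re.comp h2)).continuousOn
  · -- `Ũ > 0`
    intro t _
    exact hlam.trans_le (hlamU (tc t) (htcS t))
  · -- the hulls `K_t ∈ 𝒬₊`, `K_t ⊆ J`, `Φ_t` a restriction map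
    intro t ht
    refine ⟨?_, ?_, Loewner.isRestrictionMap_normalizedMap (htcT0 t)⟩
    · show IsPlusHull (closure (Loewner.hull h.driving (tc t)))
      rcases ht.1.lt_or_eq with ht0 | ht0
      · rcases ht.2.lt_or_eq with hts | hts
        · have hpos : 0 < tc t := by rw [← NNReal.coe_pos, htc_coe ht]; exact ht0
          rw [h.closure_hull_driving_of_lt hpos (htc_lt ⟨ht.1, hts⟩)]
          refine h.isPlusHull_slit (h.sigmaR_mem_Ioo ⟨?_, ?_⟩)
          · rw [htc_coe ht]; exact ht0
          · rw [htc_coe ht]; exact hts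
        · rw [hts, htcs, hKS]
          exact hJp
      · rw [← ht0, htc0, Loewner.hull_zero_holds hW, closure_empty]
        exact isPlusHull_empty
    · show closure (Loewner.hull h.driving (tc t)) ⊆ J
      conv_rhs => rw [← hKS]
      exact closure_mono (Loewner.hull_mono _ (htcS t))
  · show closure (Loewner.hull h.driving (tc 0)) = ∅
    rw [htc0, Loewner.hull_zero_holds hW, closure_empty]
  · show closure (Loewner.hull h.driving (tc h.termTimeR)) = J
    rw [htcs, hKS]
  · intro a _ b _ hab
    exact closure_mono (Loewner.hull_mono _ (htc_mono hab))
  · -- the tip `Ũ_t ∈ cl Φ_t((J \ K_t) ∩ ℍ)`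
    intro t ht
    have hmem := Loewner.driving_mem_closure_image_hull_diff hW (htc_lt ht)
    set c : ℂ := (((Loewner.map h.driving (tc t) 0).re : ℝ) : ℂ) with hc
    have hcont : Continuous fun w : ℂ ↦ w - c := continuous_id.sub continuous_const
    have h1 := image_closure_subset_closure_image hcont ⟨_, hmem, rfl⟩
    have hY : Loewner.hull h.driving h.termTime \ Loewner.hull h.driving (tc t) ⊆
        (J \ closure (Loewner.hull h.driving (tc t))) ∩ upperHalfPlaneSet := by
      rintro w ⟨hwS, hwt⟩
      have hwH : w ∈ upperHalfPlaneSet := Loewner.hull_subset _ _ hwS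
      refine ⟨⟨hKS ▸ subset_closure hwS, fun hw ↦ hwt ?_⟩, hwH⟩
      rw [← Loewner.closure_hull_inter hW]
      exact ⟨hw, hwH⟩
    have h2 : (fun w ↦ w - c) '' (Loewner.map h.driving (tc t) ''
        (Loewner.hull h.driving h.termTime \ Loewner.hull h.driving (tc t))) ⊆
        Loewner.normalizedMap (tc t) hW '' ((J \ closure (Loewner.hull h.driving (tc t))) ∩
          upperHalfPlaneSet) := by
      rw [image_image]
      rintro _ ⟨w, hw, rfl⟩
      exact ⟨w, hY hw, by rw [Loewner.normalizedMap_apply]⟩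
    have h3 := closure_mono h2 h1
    convert h3 using 2
    push_cast
    rfl
  · -- joint continuity
    have hc := Loewner.continuousOn_normalizedFlow_prod hW h0T
    have hmaps : MapsTo (fun p : ℝ × ℂ ↦ (tc p.1, p.2))
        (Icc 0 h.termTimeR ×ˢ (upperHalfPlaneSet \ J))
        (Iic h.termTime ×ˢ
          {z : ℂ | (h.termTime : WithTop ℝ≥0) < Loewner.swallowingTime h.driving z}) := by
      rintro ⟨t, z⟩ ⟨-, hz⟩
      exact ⟨htcS t, hoff hz⟩
    have hcomp := hc.comp ((htc_cont.comp continuous_fst).prodMk continuous_snd).continuousOn hmaps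
    refine hcomp.congr fun p _ ↦ ?_
    show Loewner.normalizedMap (tc p.1) hW p.2 = _
    rw [Loewner.normalizedMap_apply]
    rfl
  · -- the normalized Loewner equation
    intro z hz t ht
    have hD := Loewner.hasDerivWithinAt_normalizedFlow hW h0T (hoff hz) (t := t) ht
    have hEq : EqOn (fun τ ↦ Loewner.normalizedMap (tc τ) hW z)
        (fun τ ↦ Loewner.map h.driving τ.toNNReal z -
          (((Loewner.map h.driving τ.toNNReal 0).re : ℝ) : ℂ)) (Icc 0 h.termTimeR) := by
      intro τ hτ
      show Loewner.normalizedMap (tc τ) hW z = _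
      rw [Loewner.normalizedMap_apply, htc_of_mem hτ]
    refine ((hD.congr hEq (hEq ht)).congr_deriv ?_)
    show _ = 2 * Loewner.normalizedMap (tc t) hW z / ((Loewner.normalizedMap (tc t) hW z -
      ((h.driving (tc t) - (Loewner.map h.driving (tc t) 0).re : ℝ) : ℂ)) *
        ((h.driving (tc t) - (Loewner.map h.driving (tc t) 0).re : ℝ) : ℂ))
    rw [Loewner.normalizedMap_apply, htc_of_mem ht]

end Literature.Probability.RandomPlanarGeometry

end
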